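import Summits.QuantumFields.BalabanUV.Beta.GAN24.EffectiveFormVolumeLimit

/-!
# `BalabanUV.Beta.GAN24.DiagramVolumeLimit` — binder row G-an2-4 ∕ (CONV-C), route R7 «TWO CURRENCIES», PART 140: THE GENERIC `ℤ^d` END FOR ANY (UD)+(SR) TOWER WITH ENTRY LIMITS,
# THE COMPLEX ENTRY LIMITS OF THE EFFECTIVE FORM AT EVERY PAIR OF INTEGER SITES, AND THE ONE-LOOP BUBBLE `Σ_k ⊙ Σ_kᵀ` ON `ℤ^d` UNCONDITIONALLY.
# §1 makes PART 134's §3 GENERIC: a volume-indexed family of towers `c_t k` on the unit index sets of the cubic tori `(ℤ∕side t)^d` with (UD)+(SR) in the `distK` currency, constants free of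
# `t` and `k`, whose entries read from the origin CONVERGE (in `ℂ`) as `side t → ∞`, delivers the β-cell's whole `LimitRate` list on `ℤ^d` (`IsInfiniteVolumeLimit` of the real parts,
# `UniformDecay`, `StepRate`, `KernelInputs`, `|secondMoment (Π k) − secondMoment Π_∞| ≤ c₀θ^k`) — so every diagram of the lineage inherits the END from TWO checks: PART 130–132's algebra
# for (UD)+(SR) and an entrywise limit.  §2: shift invariance passes to inverses, hence to `Σ_k = c_k⁻¹ − a·1`; with PART 137's `exists_tendsto_inv_kernel` on PART 138's inputs EVERY entry
# `Σ_k(e(ẑ,μ), e(ẑ′,ν))`, `z, z′ ∈ ℤ^d`, converges in `ℂ` along the even cubic volumes (`d ≥ 3`).  §3: the bubble `Σ_k ⊙ Σ_kᵀ` (PART 132's `twoLevelDecayRate_bubble_effForm`) therefore has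
# the END with NOTHING displayed (unit b2b-balaban-gan24-p3, gen 54; v1)

NOT IN PRINT; OUR PROOF ([folklore] bookkeeping BY NAME over PART 133 (`uniformDecay_of_isInfiniteVolumeLimit`, `stepRate_of_isInfiniteVolumeLimit`, `exists_kernelInputs_of_volumeUniform`,
`abs_secondMoment_sub_le_of_volumeUniform`), PART 134 (`window_bounds_of_decay`), PART 136 (`isInfiniteVolumeLimit_kdelta`), PART 137 (`exists_tendsto_inv_kernel`, `shiftInv_one`), PART 138
(`reindex_unitCovB_shift`, `opNorm_one_sub_smul_unitCovB_le`, `one_sub_gammaB_div_Cst_lt_one`, `exists_windowDecay_unitCovB`, `tendsto_reindex_unitCovB`, `reindex_inv_sub_smul_one_apply`),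
PART 132 (`twoLevelDecayRate_bubble_effForm`), Mathlib's `Matrix.inv_submatrix_equiv`; [Balaban1987RG1] (1.21)–(1.22) p. 264 LOCATE the shapes; nothing printed is a hypothesis).
HONEST FRAMING (cell contract, verbatim): «discharging `BetaPertH` makes Bałaban's UV stability UNCONDITIONAL — a real constructive-QFT result; it is NOT the
continuum limit and NOT the Clay problem.»  HONEST DEPENDENCY (verbatim): «continuum YM on T⁴ ⇐ BetaPertH ∧ nine spine estimates (0/9 proved); BetaPertH ⇐
(D1) ∧ (D4) ∧ CAP+tail; G-an2-4 gates asym, D1 and NE2/3/4.»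

WHAT THIS FILE PROVES (0 sorry, 0 `def`; `e = (unitIdx L (cubic d s))⁻¹`, `ẑ = castT (cubic d s) z`):
* §1 **`conv_of_decay_of_tendsto`** — THE GENERIC END (`d ≥ 1`, `side t → ∞`, `μ ≠ ν`): (UD) `∀ t k, EntryDecay distK (c_t k) B δ`, (SR) `∀ t, TwoLevelDecayRate distK (c_t ·) B′ δ θ` (`δ > 0`,
  `0 ≤ θ < 1`) and `∀ k μ ν z, ∃ s, c_t k (e(ẑ,μ)) (e(0,ν)) → s` ⟹ `∃ Π : ℕ → Kernel d` with `IsInfiniteVolumeLimit side (Re c_t k (e(·,μ′)) (e(0,ν′))) (Π k)` for all `k`,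
  `UniformDecay Π μ ν B (δ∕d)`, `StepRate Π μ ν B′ (δ∕d) θ`, `KernelInputs d Π` (`K.θ = θ`, `K.c₀ = β′_d(B′∕(1−θ), δ∕d)`), `∀ k, |secondMoment (Π k) μ ν − secondMoment (limKernelOf Π) μ ν| ≤ β′_d(B′∕(1−θ), δ∕d)·θ^k`.
* §2 `shiftInv_inv` (shift-invariant ⟹ inverse shift-invariant, any torus `Tor M × Fin d`), `effForm_shift` (`Σ_k` read on `Tor M × Fin d` is shift-invariant), `tendsto_one_apply_castT` (the unit
  kernel's entries at integer sites are eventually constant), **`tendsto_effForm_entry`** (`d ≥ 3`: `∀ k μ ν z z′, ∃ s : ℂ, Σ^{(2(t+1))}_k(e(ẑ,μ), e(ẑ′,ν)) → s`).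
* §3 **`conv_bubble_effForm`** — the one-loop bubble `Σ_k ⊙ Σ_kᵀ` of PART 132 on `ℤ^d`, UNCONDITIONALLY (`d ≥ 3`, `L ≥ 2`, `a > 0`, `μ ≠ ν`, even cubic volumes): the five clauses of §1 with
  PART 132's constants `(Bs², Bs′Bs + BsBs′, (κ′+κ′)∕d, √(L⁻¹))`.
WHAT IT DOES NOT DO: identify any limit kernel; the dressed one-loop diagrams `Γ₁(Σ_k ⊗ Σ_k)Γ₂ᴴ` and tadpoles (same two checks — followers); the u-derivative sector (needs a volume-limit
hypothesis on the background); `d ≤ 2`, odd volumes, `U ≠ 1`.  SUPPLIER work; no consumer of record; NEVER «G-an2-4 closed»; NOT (CONV-C), NOT D1, NOT `BetaPertH`, NOT continuum, NOT Clay.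
Records: `HOME/b2b-balaban-gan24-p3/gen54/README.md`.
-/

noncomputable section

open scoped BigOperators ComplexConjugate Matrix Matrix.Norms.L2Operator
open Filter Topology

namespace Summit.QuantumFields.BalabanUV.Beta.GAN24.DiagramVolumeLimit

open Literature.MathematicalPhysics.QuantumFieldTheory.Balaban1983to89
open Literature.MathematicalPhysics.QuantumFieldTheory.Balaban1983to89.B5Prop11Plancherel (Tor fine Cst)
open Literature.MathematicalPhysics.QuantumFieldTheory.Balaban1983to89.B12Sec2to5 (l1 betaPrime510)
open Literature.MathematicalPhysics.QuantumFieldTheory.Balaban1983to89.Beta (Site windowMap IsInfiniteVolumeLimit)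
open Literature.MathematicalPhysics.QuantumFieldTheory.Balaban1983to89.Beta.FreeLegDictionary (cubic)
open Literature.MathematicalPhysics.QuantumFieldTheory.Balaban1983to89.Beta.BlockKernelVolumeSockets (evenPeriod tendsto_evenPeriod)
open Literature.MathematicalPhysics.QuantumFieldTheory.Balaban1983to89.Beta.VectorTails (castT castT_add castT_neg)
open Literature.MathematicalPhysics.QuantumFieldTheory.Balaban1983to89.Beta.LimitRate (StepRate limKernelOf KernelInputs)
open Summit.QuantumFields.BalabanUV.T4Continuum
open Summit.QuantumFields.BalabanUV.T4Continuum.BalabanAveragedTowerUnit (idx unitCovB)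
open Summit.QuantumFields.BalabanUV.T4Continuum.BalabanAveragedCoerciveTower (unitIdx)
open Summit.QuantumFields.BalabanUV.T4Continuum.BalabanAveragedCoercive (gammaB)
open Summit.QuantumFields.BalabanUV.T4Continuum.CTKingTowerWeights (distK)
open Summit.QuantumFields.BalabanUV.T4Continuum.DecayRateInterpolation (EntryDecay TwoLevelDecayRate)
open Summit.QuantumFields.BalabanUV.Beta.GAN24.DiagramDecayAlgebra (entryDecay_hadamard)
open Summit.QuantumFields.BalabanUV.Beta.GAN24.DiagramDecayTorus (twoLevelDecayRate_bubble_effForm)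
open Summit.QuantumFields.BalabanUV.Beta.GAN24.DiagramDecayZdSocket (stepRate_of_isInfiniteVolumeLimit uniformDecay_of_isInfiniteVolumeLimit
  exists_kernelInputs_of_volumeUniform abs_secondMoment_sub_le_of_volumeUniform)
open Summit.QuantumFields.BalabanUV.Beta.GAN24.DiagramDecayWindow (window_bounds_of_decay)
open Summit.QuantumFields.BalabanUV.Beta.GAN24.VolumeLimitAlgebra (isInfiniteVolumeLimit_kdelta)
open Summit.QuantumFields.BalabanUV.Beta.GAN24.VolumeLimitInverse (exists_tendsto_inv_kernel shiftInv_one)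
open Summit.QuantumFields.BalabanUV.Beta.GAN24.VolumeLimitCovariance (exists_windowDecay_unitCovB tendsto_reindex_unitCovB opNorm_one_sub_smul_unitCovB_le
  one_sub_gammaB_div_Cst_lt_one reindex_unitCovB_shift reindex_inv_sub_smul_one_apply)

variable {d : ℕ} (L : ℕ) [NeZero L]

/-! ## §1 The generic `ℤ^d` end for a volume-indexed family of (UD)+(SR) towers with entry limits -/

/-- **`conv_of_decay_of_tendsto` — THE GENERIC `ℤ^d` END** [our proof] (`d ≥ 1`, `side t → ∞`, `μ ≠ ν`): a volume-indexed family of towers `c_t k` on the unit index sets of the cubic tori with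
(UD)+(SR) in the `distK` currency (constants `B, B′, δ > 0, 0 ≤ θ < 1` free of `t` and `k`) whose entries read from the origin converge in `ℂ` at every `z ∈ ℤ^d` has: limit kernels `Π_k`
(`IsInfiniteVolumeLimit` of the real parts), `Beta.LimitRate.UniformDecay Π μ ν B (δ∕d)`, `StepRate Π μ ν B′ (δ∕d) θ`, an inhabitant of `KernelInputs d Π` with `θ`, and the (AF-0r) clause
`|secondMoment (Π k) μ ν − secondMoment (limKernelOf Π) μ ν| ≤ β′_d(B′∕(1−θ), δ∕d)·θ^k` — PART 134's dictionary + PART 133's socket. [cite: Balaban1987RG1, (1.21)–(1.22) p.264 (shapes)] -/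
theorem conv_of_decay_of_tendsto (hd : 1 ≤ d) {side : ℕ → ℕ} [∀ t, NeZero (side t)] (hside : Tendsto side atTop atTop)
    {c : (t : ℕ) → ℕ → Matrix (idx L (cubic d (side t)) 0) (idx L (cubic d (side t)) 0) ℂ} {B B' δ θ : ℝ} (hδ : 0 < δ) (hθ0 : 0 ≤ θ) (hθ1 : θ < 1)
    (hud : ∀ t k, EntryDecay (distK L (cubic d (side t))) (c t k) B δ) (hsr : ∀ t, TwoLevelDecayRate (distK L (cubic d (side t))) (c t) B' δ θ)
    (hlim : ∀ k (μ ν : Fin d) (z : Fin d → ℤ), ∃ s : ℂ,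
      Tendsto (fun t => c t k ((unitIdx L (cubic d (side t))).symm (castT (cubic d (side t)) z, μ)) ((unitIdx L (cubic d (side t))).symm (0, ν))) atTop (𝓝 s))
    {μ ν : Fin d} (hne : μ ≠ ν) :
    ∃ Pinf : ℕ → B12Beta.Kernel d,
      (∀ k, IsInfiniteVolumeLimit side
        (fun t μ' ν' (z : Site d (side t)) => (c t k ((unitIdx L (cubic d (side t))).symm (z, μ')) ((unitIdx L (cubic d (side t))).symm (0, ν'))).re) (Pinf k)) ∧
      Beta.LimitRate.UniformDecay Pinf μ ν B (δ / d) ∧ StepRate Pinf μ ν B' (δ / d) θ ∧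
      (∃ K : KernelInputs d Pinf, K.θ = θ ∧ K.c₀ = betaPrime510 d (B' / (1 - θ)) (δ / d) ∧ K.Pinf = limKernelOf Pinf ∧ K.μ = μ ∧ K.ν = ν) ∧
      (∀ k, |B12Beta.secondMoment (Pinf k) μ ν - B12Beta.secondMoment (limKernelOf Pinf) μ ν| ≤ betaPrime510 d (B' / (1 - θ)) (δ / d) * θ ^ k) := by
  have hd0 : (0 : ℝ) < d := by exact_mod_cast lt_of_lt_of_le zero_lt_one hd
  have hδd : 0 < δ / d := div_pos hδ hd0
  choose s hs using hlim
  refine ⟨fun k μ' ν' z => (s k μ' ν' z).re, ?_⟩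
  have hlimre : ∀ k, IsInfiniteVolumeLimit side
      (fun t μ' ν' (z : Site d (side t)) => (c t k ((unitIdx L (cubic d (side t))).symm (z, μ')) ((unitIdx L (cubic d (side t))).symm (0, ν'))).re)
      (fun μ' ν' z => (s k μ' ν' z).re) :=
    fun k μ' ν' z => (Complex.continuous_re.tendsto _).comp (hs k μ' ν' z)
  have hUDv : ∀ k, Beta.UniformDecay side
      (fun t μ' ν' (z : Site d (side t)) => (c t k ((unitIdx L (cubic d (side t))).symm (z, μ')) ((unitIdx L (cubic d (side t))).symm (0, ν'))).re) B (δ / d) := by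
    intro k t μ' ν' z
    have := (window_bounds_of_decay L (side t) hδ.le (hud t) (hsr t) μ' ν').1 k z
    simpa only [neg_mul] using this
  have hSRv : ∀ k t (z : Site d (side t)),
      |(c t (k + 1) ((unitIdx L (cubic d (side t))).symm (z, μ)) ((unitIdx L (cubic d (side t))).symm (0, ν))).re
        - (c t k ((unitIdx L (cubic d (side t))).symm (z, μ)) ((unitIdx L (cubic d (side t))).symm (0, ν))).re|
        ≤ B' * θ ^ k * Real.exp (-(δ / d) * l1 (windowMap d (side t) z)) :=
    fun k t z => (window_bounds_of_decay L (side t) hδ.le (hud t) (hsr t) μ ν).2 k z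
  exact ⟨hlimre, uniformDecay_of_isInfiniteVolumeLimit hside hlimre hUDv μ ν, stepRate_of_isInfiniteVolumeLimit hside hlimre hSRv,
    exists_kernelInputs_of_volumeUniform hside hlimre hne hδd hδd hθ0 hθ1 hUDv hSRv,
    abs_secondMoment_sub_le_of_volumeUniform hside hlimre hne hδd hδd hθ0 hθ1 hUDv hSRv⟩

/-! ## §2 Shift invariance passes to inverses; the complex entry limits of the effective form at every pair of integer sites -/

section Shift

variable (M : Fin d → ℕ) [hM : ∀ μ, NeZero (M μ)]

/-- **shift invariance passes to the inverse** (the inverse of a matrix commuting with the translations commutes with them: `Matrix.inv_submatrix_equiv`). [folklore] -/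
theorem shiftInv_inv {A : Matrix (Tor M × Fin d) (Tor M × Fin d) ℂ} (hA : ∀ x μ y ν v, A (x + v, μ) (y + v, ν) = A (x, μ) (y, ν))
    (x : Tor M) (μ : Fin d) (y : Tor M) (ν : Fin d) (v : Tor M) : A⁻¹ (x + v, μ) (y + v, ν) = A⁻¹ (x, μ) (y, ν) := by
  set σ : Tor M × Fin d ≃ Tor M × Fin d := Equiv.prodCongr (Equiv.addRight v) (Equiv.refl (Fin d)) with hσ
  have hsub : A.submatrix σ σ = A := by
    ext ⟨x', μ'⟩ ⟨y', ν'⟩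
    simp only [Matrix.submatrix_apply, hσ, Equiv.prodCongr_apply, Prod.map_apply, Equiv.coe_addRight, Equiv.coe_refl, id]
    exact hA x' μ' y' ν' v
  have h : A⁻¹.submatrix σ σ = A⁻¹ := by rw [← Matrix.inv_submatrix_equiv A σ σ, hsub]
  have := congr_fun (congr_fun h (x, μ)) (y, ν)
  simpa only [Matrix.submatrix_apply, hσ, Equiv.prodCongr_apply, Prod.map_apply, Equiv.coe_addRight, Equiv.coe_refl, id] using this

end Shift

variable (a : ℝ) (ha : 0 < a)

/-- **`Σ_k` READ ON `Tor M × Fin d` IS SHIFT-INVARIANT**: `Σ_k(e(x+v,μ), e(y+v,ν)) = Σ_k(e(x,μ), e(y,ν))` (`c_k` is, PART 138; inverses §2; the unit kernel, PART 137). [folklore] -/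
theorem effForm_shift (M : Fin d → ℕ) [∀ μ, NeZero (M μ)] (k : ℕ) (x : Tor M) (μ : Fin d) (y : Tor M) (ν : Fin d) (v : Tor M) :
    ((unitCovB L M a ha k)⁻¹ - (a : ℂ) • (1 : Matrix (idx L M 0) (idx L M 0) ℂ)) ((unitIdx L M).symm (x + v, μ)) ((unitIdx L M).symm (y + v, ν))
      = ((unitCovB L M a ha k)⁻¹ - (a : ℂ) • (1 : Matrix (idx L M 0) (idx L M 0) ℂ)) ((unitIdx L M).symm (x, μ)) ((unitIdx L M).symm (y, ν)) := by
  have h1 : (1 : Matrix (Tor M × Fin d) (Tor M × Fin d) ℂ) (x + v, μ) (y + v, ν) = (1 : Matrix (Tor M × Fin d) (Tor M × Fin d) ℂ) (x, μ) (y, ν) := by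
    simp only [Matrix.one_apply, Prod.mk.injEq, add_left_inj]
  rw [← reindex_inv_sub_smul_one_apply, ← reindex_inv_sub_smul_one_apply, Matrix.sub_apply, Matrix.sub_apply, Matrix.smul_apply, Matrix.smul_apply,
    shiftInv_inv M (reindex_unitCovB_shift L M a ha k) x μ y ν v, h1]

/-- the unit kernel's entry at the integer sites `(ẑ_t, μ), (0, ν)` is eventually the constant `[z = 0]·[μ = ν]` (PART 136's `isInfiniteVolumeLimit_kdelta`, complex form). [folklore] -/
theorem tendsto_one_apply_castT {side : ℕ → ℕ} [∀ t, NeZero (side t)] (hside : Tendsto side atTop atTop) (μ ν : Fin d) (z : Fin d → ℤ) :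
    Tendsto (fun t => (1 : Matrix (Tor (cubic d (side t)) × Fin d) (Tor (cubic d (side t)) × Fin d) ℂ) (castT (cubic d (side t)) z, μ) (0, ν)) atTop
      (𝓝 (((if z = 0 ∧ μ = ν then (1 : ℝ) else 0 : ℝ) : ℂ))) := by
  have h := (Complex.continuous_ofReal.tendsto _).comp (isInfiniteVolumeLimit_kdelta (d := d) hside μ ν z)
  refine h.congr fun t => ?_
  simp only [Function.comp_apply, Matrix.one_apply, Prod.mk.injEq, apply_ite Complex.ofReal, Complex.ofReal_one, Complex.ofReal_zero]
  rfl

/-- **`tendsto_effForm_entry` — EVERY ENTRY OF THE EFFECTIVE FORM AT A PAIR OF INTEGER SITES CONVERGES IN `ℂ`** (`d ≥ 3`, any `L ≥ 1`, `a > 0`, along the even cubic volumes `2(t+1)`):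
`∃ s, Σ^{(2(t+1))}_k(e(ẑ,μ), e(ẑ′,ν)) → s` for all `k, μ, ν, z, z′` — shift to `z − z′` (`effForm_shift`), then PART 137's `exists_tendsto_inv_kernel` on PART 138's (α)(β)(γ)+shift invariance for the
inverse part and `tendsto_one_apply_castT` for the unit kernel. [cite: Balaban1987RG1, p.264 (after (1.21): the `T ↗ ℤ^d` limit)] -/
theorem tendsto_effForm_entry (hd : 3 ≤ d) (k : ℕ) (μ ν : Fin d) (z z' : Fin d → ℤ) :
    ∃ s : ℂ, Tendsto (fun t => ((unitCovB L (cubic d (evenPeriod t)) a ha k)⁻¹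
        - (a : ℂ) • (1 : Matrix (idx L (cubic d (evenPeriod t)) 0) (idx L (cubic d (evenPeriod t)) 0) ℂ))
        ((unitIdx L (cubic d (evenPeriod t))).symm (castT (cubic d (evenPeriod t)) z, μ)) ((unitIdx L (cubic d (evenPeriod t))).symm (castT (cubic d (evenPeriod t)) z', ν)))
      atTop (𝓝 s) := by
  have hd1 : 1 ≤ d := le_trans (by norm_num) hd
  obtain ⟨κ, B, hκ, -, hdec⟩ := exists_windowDecay_unitCovB L a ha
  have hδ : 0 < κ / d := div_pos hκ (by exact_mod_cast lt_of_lt_of_le zero_lt_one hd1)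
  have hlim' := fun μ ν x => tendsto_reindex_unitCovB L a ha hd k μ ν x
  choose Kc hKc using hlim'
  obtain ⟨s, hs⟩ := exists_tendsto_inv_kernel (d := d) tendsto_evenPeriod
    (A := fun t => Matrix.reindex (unitIdx L (cubic d (evenPeriod t))) (unitIdx L (cubic d (evenPeriod t))) (unitCovB L (cubic d (evenPeriod t)) a ha k))
    (fun t => opNorm_one_sub_smul_unitCovB_le L (cubic d (evenPeriod t)) a ha hd1 k) (one_sub_gammaB_div_Cst_lt_one a ha)
    (fun t x μ y ν v => reindex_unitCovB_shift L (cubic d (evenPeriod t)) a ha k x μ y ν v)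
    (fun t μ ν w => hdec (evenPeriod t) k μ ν w) hδ (Kinf := Kc) (fun μ ν x => hKc μ ν x) μ ν (z - z')
  refine ⟨s - (a : ℂ) * (((if z - z' = 0 ∧ μ = ν then (1 : ℝ) else 0 : ℝ) : ℂ)), ?_⟩
  have hshift : ∀ t, ((unitCovB L (cubic d (evenPeriod t)) a ha k)⁻¹
        - (a : ℂ) • (1 : Matrix (idx L (cubic d (evenPeriod t)) 0) (idx L (cubic d (evenPeriod t)) 0) ℂ))
        ((unitIdx L (cubic d (evenPeriod t))).symm (castT (cubic d (evenPeriod t)) z, μ)) ((unitIdx L (cubic d (evenPeriod t))).symm (castT (cubic d (evenPeriod t)) z', ν))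
      = (Matrix.reindex (unitIdx L (cubic d (evenPeriod t))) (unitIdx L (cubic d (evenPeriod t))) (unitCovB L (cubic d (evenPeriod t)) a ha k))⁻¹
          (castT (cubic d (evenPeriod t)) (z - z'), μ) (0, ν)
        - (a : ℂ) * (1 : Matrix (Tor (cubic d (evenPeriod t)) × Fin d) (Tor (cubic d (evenPeriod t)) × Fin d) ℂ) (castT (cubic d (evenPeriod t)) (z - z'), μ) (0, ν) := by
    intro t
    have e1 : castT (cubic d (evenPeriod t)) z = castT (cubic d (evenPeriod t)) (z - z') + castT (cubic d (evenPeriod t)) z' := by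
      rw [sub_eq_add_neg, castT_add, castT_neg, neg_add_cancel_right]
    have hsh := effForm_shift L a ha (cubic d (evenPeriod t)) k (castT (cubic d (evenPeriod t)) (z - z')) μ 0 ν (castT (cubic d (evenPeriod t)) z')
    rw [zero_add, ← e1] at hsh
    rw [hsh, ← reindex_inv_sub_smul_one_apply, Matrix.sub_apply, Matrix.smul_apply, smul_eq_mul]
  simp only [hshift]
  exact hs.sub ((tendsto_one_apply_castT (d := d) tendsto_evenPeriod μ ν (z - z')).const_mul (a : ℂ))

/-! ## §3 The one-loop bubble `Σ_k ⊙ Σ_kᵀ` on `ℤ^d`, unconditionally -/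

/-- **`conv_bubble_effForm` — THE ONE-LOOP BUBBLE OF THE EFFECTIVE FORM ON `ℤ^d`, UNCONDITIONALLY** [our proof] (`d ≥ 3`, `L ≥ 2`, `a > 0`, `μ ≠ ν`, along the even cubic volumes
`side t = 2(t+1)`): for the Hadamard bubble `Σ_k ⊙ Σ_kᵀ` (`Σ_k = (Q_k𝒢Q_kᴴ)⁻¹ − a·1`) there are `κ′ > 0`, `Bs, Bs′ ≥ 0` (PART 132's, from `(d, L, a)`) and limit kernels `Π_k` with
`IsInfiniteVolumeLimit evenPeriod (Re (Σ_k ⊙ Σ_kᵀ)(e(·,μ′), e(0,ν′))) (Π k)` for all `k`, `UniformDecay Π μ ν (Bs·Bs) ((κ′+κ′)∕d)`, `StepRate Π μ ν (Bs′Bs + BsBs′) ((κ′+κ′)∕d) (√(L⁻¹))`,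
`KernelInputs d Π` inhabited, and `∀ k, |secondMoment (Π k) μ ν − secondMoment (limKernelOf Π) μ ν| ≤ β′_d((Bs′Bs + BsBs′)∕(1−√(L⁻¹)), (κ′+κ′)∕d)·(√(L⁻¹))^k` — the literal
`LimitForm.conv` shape for a one-loop DIAGRAM of the lineage, with no displayed binder. [cite: Balaban1987RG1, (1.21)–(1.22) p.264 (shapes)] -/
theorem conv_bubble_effForm (hL : 2 ≤ L) (hd : 3 ≤ d) {μ ν : Fin d} (hne : μ ≠ ν) :
    ∃ κ' Bs Bs' : ℝ, 0 < κ' ∧ 0 ≤ Bs ∧ 0 ≤ Bs' ∧ ∃ Pinf : ℕ → B12Beta.Kernel d,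
      (∀ k, IsInfiniteVolumeLimit evenPeriod
        (fun t μ' ν' (z : Site d (evenPeriod t)) =>
          ((((unitCovB L (cubic d (evenPeriod t)) a ha k)⁻¹ - (a : ℂ) • (1 : Matrix (idx L (cubic d (evenPeriod t)) 0) (idx L (cubic d (evenPeriod t)) 0) ℂ)) ⊙
            ((unitCovB L (cubic d (evenPeriod t)) a ha k)⁻¹ - (a : ℂ) • (1 : Matrix (idx L (cubic d (evenPeriod t)) 0) (idx L (cubic d (evenPeriod t)) 0) ℂ))ᵀ)
            ((unitIdx L (cubic d (evenPeriod t))).symm (z, μ')) ((unitIdx L (cubic d (evenPeriod t))).symm (0, ν'))).re) (Pinf k)) ∧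
      Beta.LimitRate.UniformDecay Pinf μ ν (Bs * Bs) ((κ' + κ') / d) ∧ StepRate Pinf μ ν (Bs' * Bs + Bs * Bs') ((κ' + κ') / d) (Real.sqrt ((L : ℝ)⁻¹)) ∧
      (∃ K : KernelInputs d Pinf, K.θ = Real.sqrt ((L : ℝ)⁻¹) ∧ K.c₀ = betaPrime510 d ((Bs' * Bs + Bs * Bs') / (1 - Real.sqrt ((L : ℝ)⁻¹))) ((κ' + κ') / d) ∧
        K.Pinf = limKernelOf Pinf ∧ K.μ = μ ∧ K.ν = ν) ∧
      (∀ k, |B12Beta.secondMoment (Pinf k) μ ν - B12Beta.secondMoment (limKernelOf Pinf) μ ν|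
          ≤ betaPrime510 d ((Bs' * Bs + Bs * Bs') / (1 - Real.sqrt ((L : ℝ)⁻¹))) ((κ' + κ') / d) * Real.sqrt ((L : ℝ)⁻¹) ^ k) := by
  have hd1 : 1 ≤ d := le_trans (by norm_num) hd
  obtain ⟨κ', Bs, Bs', hκ', hBs, hBs', h⟩ := twoLevelDecayRate_bubble_effForm L a ha hL (le_trans (by norm_num) hd)
  have hL1 : (1 : ℝ) < L := by exact_mod_cast (lt_of_lt_of_le one_lt_two hL : 1 < L)
  have hθ0 : 0 ≤ Real.sqrt ((L : ℝ)⁻¹) := Real.sqrt_nonneg _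
  have hθ1 : Real.sqrt ((L : ℝ)⁻¹) < 1 := by
    rw [show (1 : ℝ) = Real.sqrt 1 from Real.sqrt_one.symm]
    exact Real.sqrt_lt_sqrt (inv_nonneg.mpr (Nat.cast_nonneg _)) (inv_lt_one_of_one_lt₀ hL1)
  refine ⟨κ', Bs, Bs', hκ', hBs, hBs', ?_⟩
  refine conv_of_decay_of_tendsto L hd1 tendsto_evenPeriod (add_pos hκ' hκ') hθ0 hθ1 (fun t => (h (cubic d (evenPeriod t))).1) (fun t => (h (cubic d (evenPeriod t))).2) ?_ hne
  intro k μ' ν' z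
  obtain ⟨s₁, hs₁⟩ := tendsto_effForm_entry L a ha hd k μ' ν' z 0
  obtain ⟨s₂, hs₂⟩ := tendsto_effForm_entry L a ha hd k ν' μ' 0 z
  refine ⟨s₁ * s₂, ?_⟩
  have e0 : ∀ t, castT (cubic d (evenPeriod t)) (0 : Fin d → ℤ) = 0 := fun t => by funext i; simp [castT]
  simp only [e0] at hs₁ hs₂
  simp only [Matrix.hadamard_apply, Matrix.transpose_apply]
  exact hs₁.mul hs₂

end Summit.QuantumFields.BalabanUV.Beta.GAN24.DiagramVolumeLimit

end
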